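import Summits.Ventures.WeilGRH.TwistedMomentChainAbs
import Summits.Ventures.WeilGRH.BaseRungOddTransfer
import HarnessLib

/-!
# Moment-method certificates for TWISTED Weil weights, II: cells for the weights with a signed prime-2 ripple

Cell `rh-explicit`, WEIL TRACK — GRH ARM (Lean root `Summits/Ventures/WeilGRH/`, namespace
`Summit.Ventures.WeilGRH`).  On the window `2t ≤ log 3` the twisted form of a Dirichlet character `χ` with
REAL `χ(2) = s ∈ {−1, 0, 1}` has the frequency-side weight
(`Literature.NumberTheory.LFunctions.weilFinitePrimeWeightChar χ 2`)

  `M_{χ,2}(τ) = Re ψ(1/4 + a_χ/2 + iτ/2) + (log q − log π) + s · (−√2 log 2 cos(τ log 2))`;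

the `ζ` first-prime weight `w₂` is the case `s = 1`, `a = 0`, level `−log π`.  This file supplies the
cell checker for the **twisted model weight**

  `twistWeight s τ = Re ψ(1/4 + iτ/2) + s · (−√2 log 2 cos(τ log 2))`     (`s : ℤ`, `|s| ≤ 1`),

a minorant of `M_{χ,2} − (log q − log π)` for BOTH parities (`Re ψ(3/4 + iy) ≥ Re ψ(1/4 + iy)`; the parity
bonus is dropped here — sufficient for EVEN characters such as the Legendre symbol mod 5; odd characters that
need the bonus get a further cell layer in a later file):

* `alphaHiQ`, `betaHiQ` — engine UPPER bounds of `α(u) = −√2 log 2 cos(u log 2)`, `β(u) = √2 log 2 sin(u log 2)`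
  (the lower bounds `alphaLoQ`, `betaLoQ` are the `ζ` file's), so that the claimed cell constants
  `alo ≤ s·α(u)`, `blo ≤ s·β(u)` can be checked for each sign (`FPDCell.checkRippleS`);
* `FPDCell.checkZS s p j` — the integer cell checker of `WeilCellsZ.lean` with the ripple test replaced by
  `checkRippleS`; soundness `FPDCell.sigma_le_ZS` (`σ ≤ twistWeight s` on the cell) and
  `cellValidW_of_checkZS` (`CellValidW c (twistWeight s)`);
* `checkCellsZS s p j wL T M cells` — chain from `0` to `T`, every cell `checkZS`, dyadic `T`, and the tail
  level test `wL + |s|·(√2 log 2)⁺ ≤ wLoZ(T)`; **`cellsOKW_of_checkCellsZS`**: it yields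
  `CellsOKW wL T cells (twistWeight s)` of `TwistedMomentChain.lean`;
* `twistWeight_neg` (evenness), `twistWeight_zero_le_of_parity` (`twistWeight s ≤` the digamma weight of
  either parity plus the ripple).

The cell DATA type is the `ζ` side's `FPDCell` unchanged (so generators and the exact-moment layer are shared);
only the meaning of the claimed constants `alo`, `blo` changes with `s`.  Everything here is PROVED; no named
facts.

## References

* H. Yoshida, *On Hermitian forms attached to zeta functions*, Adv. Stud. Pure Math. 21 (1992), §6.
* R. E. Moore, *Interval Analysis* (1966), Ch. 3 (interval extensions of `cos`, `sin`).
-/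

noncomputable section

open Complex Finset MeasureTheory Set Filter
open scoped Real Topology BigOperators

namespace Summit.Ventures.WeilGRH

open Literature.NumberTheory.LFunctions
open Literature.Analysis.ValidatedNumerics.Numerics
open Literature.Analysis.SpecialFunctions

/-! ## The twisted model weight -/

/-- The twisted model weight `twistWeight s τ = Re ψ(1/4 + iτ/2) + s · (−√2 log 2 cos(τ log 2))`:
for `s = Re χ(2) ∈ {−1, 0, 1}` a minorant (exact for even `χ`) of `M_{χ,2}(τ) − (log q − log π)`. [folklore] -/
def twistWeight (s : ℤ) (τ : ℝ) : ℝ :=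
  reDigammaQuarter τ + (s : ℝ) * (-(Real.sqrt 2 * Real.log 2 * Real.cos (τ * Real.log 2)))

/-- `twistWeight s` is even. [folklore] -/
theorem twistWeight_neg (s : ℤ) (τ : ℝ) : twistWeight s (-τ) = twistWeight s τ := by
  unfold twistWeight
  rw [← reDigammaQuarter_abs (-τ), abs_neg, reDigammaQuarter_abs, neg_mul, Real.cos_neg]

/-- Tail bound: for `|s| ≤ 1` and `|τ| ≥ T ≥ 0`, `Re ψ(1/4 + iT/2) − |s| √2 log 2 ≤ twistWeight s τ`. [folklore] -/
theorem twistWeight_ge_tail {s : ℤ} {T τ : ℝ} (hT : 0 ≤ T) (hτ : T ≤ |τ|) :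
    reDigammaQuarter T - |(s : ℝ)| * (Real.sqrt 2 * Real.log 2) ≤ twistWeight s τ := by
  unfold twistWeight
  have h1 : reDigammaQuarter T ≤ reDigammaQuarter τ :=
    reDigammaQuarter_mono (by rwa [abs_of_nonneg hT])
  have hc0 : 0 ≤ Real.sqrt 2 * Real.log 2 := by positivity
  have h2 : |(s : ℝ) * (-(Real.sqrt 2 * Real.log 2 * Real.cos (τ * Real.log 2)))| ≤
      |(s : ℝ)| * (Real.sqrt 2 * Real.log 2) := by
    rw [abs_mul, abs_neg]
    refine mul_le_mul_of_nonneg_left ?_ (abs_nonneg _)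
    rw [abs_mul, abs_of_nonneg hc0]
    exact mul_le_of_le_one_right hc0 (Real.abs_cos_le_one _)
  linarith [neg_abs_le ((s : ℝ) * (-(Real.sqrt 2 * Real.log 2 * Real.cos (τ * Real.log 2))))]

/-! ## Engine upper bounds of the ripple constants -/

/-- A rational `≥ α(u) := −√2 log 2 · cos(u log 2)`. [folklore] -/
def alphaHiQ (u : ℚ) : ℚ := (FI.neg (FI.mul cZeroFI (FI.cosSin (thetaFI u)).1)).hiQ

/-- A rational `≥ β(u) := √2 log 2 · sin(u log 2)`. [folklore] -/
def betaHiQ (u : ℚ) : ℚ := (FI.mul cZeroFI (FI.cosSin (thetaFI u)).2).hiQ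

/-- `−√2 log 2 cos(u log 2) ≤ alphaHiQ u`. [folklore] -/
theorem le_alphaHiQ (u : ℚ) :
    -(Real.sqrt 2 * Real.log 2 * Real.cos ((u : ℝ) * Real.log 2)) ≤ (alphaHiQ u : ℝ) := by
  have h := (FI.mem_cosSin (mem_thetaFI u)).1
  exact FI.le_hiQ (FI.mem_neg (FI.mem_mul mem_cZeroFI h))

/-- `√2 log 2 sin(u log 2) ≤ betaHiQ u`. [folklore] -/
theorem le_betaHiQ (u : ℚ) :
    Real.sqrt 2 * Real.log 2 * Real.sin ((u : ℝ) * Real.log 2) ≤ (betaHiQ u : ℝ) := by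
  have h := (FI.mem_cosSin (mem_thetaFI u)).2
  exact FI.le_hiQ (FI.mem_mul mem_cZeroFI h)

/-! ## The signed ripple test and the cell checker -/

namespace FPDCell

/-- The claimed constants `alo ≤ s·α(u)`, `blo ≤ s·β(u)` checked against the engine for the sign `s`:
`s = 1`: `alo ≤ alphaLoQ u`, `blo ≤ betaLoQ u`; `s = −1`: `alo ≤ −alphaHiQ u`, `blo ≤ −betaHiQ u`;
`s = 0`: `alo ≤ 0`, `blo ≤ 0`; any other `s` is refused. [folklore] -/
def checkRippleS (s : ℤ) (c : FPDCell) : Bool :=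
  if s = 1 then decide (c.alo ≤ alphaLoQ c.psi.u) && decide (c.blo ≤ betaLoQ c.psi.u)
  else if s = -1 then decide (c.alo ≤ -alphaHiQ c.psi.u) && decide (c.blo ≤ -betaHiQ c.psi.u)
  else if s = 0 then decide (c.alo ≤ 0) && decide (c.blo ≤ 0)
  else false

/-- Soundness of the signed ripple test: `alo ≤ s·α(u)` and `blo ≤ s·β(u)`. [folklore] -/
theorem checkRippleS_spec {s : ℤ} {c : FPDCell} (h : checkRippleS s c = true) :
    (c.alo : ℝ) ≤ (s : ℝ) * -(Real.sqrt 2 * Real.log 2 * Real.cos ((c.psi.u : ℝ) * Real.log 2)) ∧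
      (c.blo : ℝ) ≤ (s : ℝ) * (Real.sqrt 2 * Real.log 2 * Real.sin ((c.psi.u : ℝ) * Real.log 2)) := by
  unfold checkRippleS at h
  by_cases h1 : s = 1
  · rw [if_pos h1] at h
    simp only [Bool.and_eq_true, decide_eq_true_eq] at h
    subst h1
    push_cast
    rw [one_mul, one_mul]
    exact ⟨le_trans (by exact_mod_cast h.1) (alphaLoQ_le c.psi.u),
      le_trans (by exact_mod_cast h.2) (betaLoQ_le c.psi.u)⟩
  · rw [if_neg h1] at h
    by_cases h2 : s = -1
    · rw [if_pos h2] at h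
      simp only [Bool.and_eq_true, decide_eq_true_eq] at h
      subst h2
      push_cast
      rw [neg_one_mul, neg_one_mul]
      have ha : ((c.alo : ℚ) : ℝ) ≤ -((alphaHiQ c.psi.u : ℚ) : ℝ) := by exact_mod_cast h.1
      have hb : ((c.blo : ℚ) : ℝ) ≤ -((betaHiQ c.psi.u : ℚ) : ℝ) := by exact_mod_cast h.2
      exact ⟨ha.trans (neg_le_neg (le_alphaHiQ c.psi.u)), hb.trans (neg_le_neg (le_betaHiQ c.psi.u))⟩
    · rw [if_neg h2] at h
      by_cases h3 : s = 0
      · rw [if_pos h3] at h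
        simp only [Bool.and_eq_true, decide_eq_true_eq] at h
        subst h3
        push_cast
        rw [zero_mul, zero_mul]
        exact ⟨by exact_mod_cast h.1, by exact_mod_cast h.2⟩
      · rw [if_neg h3] at h
        exact absurd h Bool.false_ne_true

/-- All checks of a twisted cell, integer form: the digamma part by `WeilCell.checkZ`, then `n ≥ 1`,
`0 ≤ Llo`, `(v − u) · Lhi ≤ 1`, the `log 2` enclosure, and the signed ripple test. [folklore] -/
def checkZS (s : ℤ) (p j : ℕ) (c : FPDCell) : Bool :=
  c.psi.checkZ p j && decide (0 < c.n) && decide (0 ≤ c.Llo) &&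
    decide ((c.psi.v - c.psi.u) * c.Lhi ≤ 1) &&
    decide (c.Llo ≤ logTwoLoQ) && decide (logTwoHiQ ≤ c.Lhi) && checkRippleS s c

variable {s : ℤ} {p j : ℕ} {c : FPDCell}

/-- Unpacking `checkZS`. [folklore] -/
theorem checkZS_spec (h : checkZS s p j c = true) :
    c.psi.checkZ p j = true ∧ 0 < c.n ∧ 0 ≤ c.Llo ∧ (c.psi.v - c.psi.u) * c.Lhi ≤ 1 ∧
      c.Llo ≤ logTwoLoQ ∧ logTwoHiQ ≤ c.Lhi ∧ checkRippleS s c = true := by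
  simp only [checkZS, Bool.and_eq_true, decide_eq_true_eq] at h
  exact ⟨h.1.1.1.1.1.1, h.1.1.1.1.1.2, h.1.1.1.1.2, h.1.1.1.2, h.1.1.2, h.1.2, h.2⟩

/-- **Signed ripple soundness.** On the cell, `P(t − u) ≤ s · (−√2 log 2 cos(t log 2))`. [folklore] -/
theorem polyR_cosPart_le_signed (hn : 0 < c.n) (hL0q : 0 ≤ c.Llo)
    (hwq : (c.psi.v - c.psi.u) * c.Lhi ≤ 1) (hLloq : c.Llo ≤ logTwoLoQ) (hLhiq : logTwoHiQ ≤ c.Lhi)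
    (ha : (c.alo : ℝ) ≤ (s : ℝ) * -(Real.sqrt 2 * Real.log 2 * Real.cos ((c.psi.u : ℝ) * Real.log 2)))
    (hb : (c.blo : ℝ) ≤ (s : ℝ) * (Real.sqrt 2 * Real.log 2 * Real.sin ((c.psi.u : ℝ) * Real.log 2)))
    {t : ℝ} (hut : (c.psi.u : ℝ) ≤ t) (htv : t ≤ (c.psi.v : ℝ)) :
    polyR c.cosPart (t - c.psi.u) ≤ (s : ℝ) * -(Real.sqrt 2 * Real.log 2 * Real.cos (t * Real.log 2)) := by
  set L : ℝ := Real.log 2 with hLdef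
  set u : ℝ := (c.psi.u : ℝ) with hudef
  set hh : ℝ := t - u with hhdef
  have hL0 : (0 : ℝ) ≤ c.Llo := by exact_mod_cast hL0q
  have hL1 : (c.Llo : ℝ) ≤ L := le_trans (by exact_mod_cast hLloq) logTwo_mem_Q.1
  have hL2 : L ≤ (c.Lhi : ℝ) := le_trans logTwo_mem_Q.2 (by exact_mod_cast hLhiq)
  have hLnn : 0 ≤ L := hL0.trans hL1
  have hh0 : 0 ≤ hh := by rw [hhdef]; linarith
  have hhw : hh ≤ (c.psi.v : ℝ) - c.psi.u := by rw [hhdef, hudef]; linarith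
  have hhL : hh * L ≤ 1 := by
    have h1 : hh * L ≤ ((c.psi.v : ℝ) - c.psi.u) * c.Lhi :=
      mul_le_mul hhw hL2 hLnn (by linarith)
    have h2 : ((c.psi.v : ℝ) - c.psi.u) * c.Lhi ≤ 1 := by exact_mod_cast hwq
    linarith
  have hy0 : 0 ≤ hh * L := mul_nonneg hh0 hLnn
  have hcos0 : 0 ≤ Real.cos (hh * L) :=
    Real.cos_nonneg_of_mem_Icc ⟨by linarith [Real.pi_pos], by linarith [Real.pi_gt_three]⟩
  have hsin0 : 0 ≤ Real.sin (hh * L) :=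
    Real.sin_nonneg_of_nonneg_of_le_pi hy0 (by linarith [Real.pi_gt_three])
  -- addition formula at the left end point, scaled by `s`
  set α : ℝ := (s : ℝ) * -(Real.sqrt 2 * Real.log 2 * Real.cos (u * L)) with hαdef
  set β : ℝ := (s : ℝ) * (Real.sqrt 2 * Real.log 2 * Real.sin (u * L)) with hβdef
  have hadd : (s : ℝ) * -(Real.sqrt 2 * Real.log 2 * Real.cos (t * Real.log 2)) =
      α * Real.cos (hh * L) + β * Real.sin (hh * L) := by
    have : t * Real.log 2 = u * L + hh * L := by rw [hhdef, hLdef]; ring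
    rw [this, Real.cos_add, hαdef, hβdef]
    ring
  have ha' : (c.alo : ℝ) ≤ α := by rw [hαdef, hudef, hLdef]; exact ha
  have hb' : (c.blo : ℝ) ≤ β := by rw [hβdef, hudef, hLdef]; exact hb
  rw [hadd, FPDCell.polyR_cosPart]
  refine add_le_add ?_ ?_
  · unfold FPDCell.cosBracket
    split_ifs with hsgn
    · have h0 : (0 : ℝ) ≤ c.alo := by exact_mod_cast hsgn
      calc (c.alo : ℝ) * polyR (cosLoCoeffs c.Llo c.Lhi c.n) hh
          ≤ (c.alo : ℝ) * Real.cos (hh * L) :=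
            mul_le_mul_of_nonneg_left (polyR_cosLo_le hL0 hL1 hL2 hh0 hhL hn) h0
        _ ≤ α * Real.cos (hh * L) := mul_le_mul_of_nonneg_right ha' hcos0
    · push Not at hsgn
      have h0 : (c.alo : ℝ) ≤ 0 := by exact_mod_cast hsgn.le
      calc (c.alo : ℝ) * polyR (cosUpCoeffs c.Llo c.Lhi c.n) hh
          ≤ (c.alo : ℝ) * Real.cos (hh * L) :=
            mul_le_mul_of_nonpos_left (cos_le_polyR_cosUp hL0 hL1 hL2 hh0 hhL hn) h0
        _ ≤ α * Real.cos (hh * L) := mul_le_mul_of_nonneg_right ha' hcos0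
  · unfold FPDCell.sinBracket
    split_ifs with hsgn
    · have h0 : (0 : ℝ) ≤ c.blo := by exact_mod_cast hsgn
      calc (c.blo : ℝ) * polyR (sinLoCoeffs c.Llo c.Lhi c.n) hh
          ≤ (c.blo : ℝ) * Real.sin (hh * L) :=
            mul_le_mul_of_nonneg_left (polyR_sinLo_le hL0 hL1 hL2 hh0 hhL hn) h0
        _ ≤ β * Real.sin (hh * L) := mul_le_mul_of_nonneg_right hb' hsin0
    · push Not at hsgn
      have h0 : (c.blo : ℝ) ≤ 0 := by exact_mod_cast hsgn.le
      calc (c.blo : ℝ) * polyR (sinUpCoeffs c.Llo c.Lhi c.n) hh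
          ≤ (c.blo : ℝ) * Real.sin (hh * L) :=
            mul_le_mul_of_nonpos_left (sin_le_polyR_sinUp hL0 hL1 hL2 hh0 hhL hn) h0
        _ ≤ β * Real.sin (hh * L) := mul_le_mul_of_nonneg_right hb' hsin0

/-- **Cell soundness (twisted integer checker).** On its cell, `σ(t) ≤ twistWeight s t`. [folklore] -/
theorem sigma_le_ZS (h : checkZS s p j c = true) {t : ℝ} (hut : (c.psi.u : ℝ) ≤ t)
    (htv : t ≤ (c.psi.v : ℝ)) : c.sigma t ≤ twistWeight s t := by
  obtain ⟨hpsi, hn, hL0q, hwq, hLloq, hLhiq, hrip⟩ := checkZS_spec h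
  obtain ⟨ha, hb⟩ := checkRippleS_spec hrip
  have h1 := WeilCell.sigma_le_Z hpsi hut htv
  have h2 := polyR_cosPart_le_signed hn hL0q hwq hLloq hLhiq ha hb hut htv
  unfold FPDCell.sigma twistWeight
  linarith

/-- A cell accepted by `checkZS s p j` is a valid minorant cell of `twistWeight s`. [folklore] -/
theorem cellValidW_of_checkZS (h : checkZS s p j c = true) : CellValidW c (twistWeight s) := by
  obtain ⟨hpsi, -, -, -, -, -, -⟩ := checkZS_spec h
  have hu0 : 0 ≤ c.psi.u := WeilCell.u_nonneg_Z hpsi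
  have huv : c.psi.u < c.psi.v := WeilCell.u_lt_v_Z hpsi
  exact ⟨hu0, huv, fun hut htv ↦ sigma_le_ZS h hut htv,
    fun wL _ hut htv ↦ FPDCell.abs_level_sub_sigma_le_of hu0 wL hut htv⟩

end FPDCell

/-! ## The chain checker -/

/-- The rational `|s| · (√2 log 2)⁺` charged to the tail level (`0` for `s = 0`). [folklore] -/
def rippleHiQ (s : ℤ) : ℚ := if s = 0 then 0 else cZeroFI.hiQ

/-- `|s| √2 log 2 ≤ rippleHiQ s` for `|s| ≤ 1`. [folklore] -/
theorem abs_mul_cZero_le_rippleHiQ {s : ℤ} (hs : |s| ≤ 1) :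
    |(s : ℝ)| * (Real.sqrt 2 * Real.log 2) ≤ (rippleHiQ s : ℝ) := by
  unfold rippleHiQ
  have hc : Real.sqrt 2 * Real.log 2 ≤ (cZeroFI.hiQ : ℝ) := FI.le_hiQ mem_cZeroFI
  have hc0 : 0 ≤ Real.sqrt 2 * Real.log 2 := by positivity
  by_cases h0 : s = 0
  · rw [if_pos h0, h0]; push_cast; rw [abs_zero, zero_mul]
  · rw [if_neg h0]
    have h1 : |(s : ℝ)| ≤ 1 := by exact_mod_cast hs
    calc |(s : ℝ)| * (Real.sqrt 2 * Real.log 2) ≤ 1 * (Real.sqrt 2 * Real.log 2) :=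
          mul_le_mul_of_nonneg_right h1 hc0
      _ ≤ (cZeroFI.hiQ : ℝ) := by rw [one_mul]; exact hc

/-- **The integer checker of a twisted chain**: chain from `0` to `T`, every cell `checkZS s p j`, `|s| ≤ 1`,
`T` dyadic (`T · 2^j ∈ ℕ`, `j ≥ 1`), and the tail level test `wL + rippleHiQ s ≤ wLoZ(T)`. [folklore] -/
def checkCellsZS (s : ℤ) (p j : ℕ) (wL T : ℚ) (M : ℕ) (cells : List FPDCell) : Bool :=
  checkChain₂ cells 0 T && cells.all (fun c ↦ FPDCell.checkZS s p j c) && decide (|s| ≤ 1) &&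
    decide (1 ≤ j) && decide (T * 2 ^ j = ((dyNum T j : ℕ) : ℚ)) &&
    decide (wL + rippleHiQ s ≤ wLoZ p (dyNum T j) j M)

/-- Unpacking `checkCellsZS`. [folklore] -/
theorem checkCellsZS_spec {s : ℤ} {p j : ℕ} {wL T : ℚ} {M : ℕ} {cells : List FPDCell}
    (h : checkCellsZS s p j wL T M cells = true) :
    checkChain₂ cells 0 T = true ∧ (∀ c ∈ cells, FPDCell.checkZS s p j c = true) ∧ |s| ≤ 1 ∧ 1 ≤ j ∧
      T * 2 ^ j = ((dyNum T j : ℕ) : ℚ) ∧ wL + rippleHiQ s ≤ wLoZ p (dyNum T j) j M := by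
  simp only [checkCellsZS, Bool.and_eq_true, List.all_eq_true, decide_eq_true_eq] at h
  exact ⟨h.1.1.1.1.1, h.1.1.1.1.2, h.1.1.1.2, h.1.1.2, h.1.2, h.2⟩

/-- **The valid chain from the twisted integer checker.** [folklore] -/
theorem cellsOKW_of_checkCellsZS {s : ℤ} {p j : ℕ} {wL T : ℚ} {M : ℕ} {cells : List FPDCell}
    (h : checkCellsZS s p j wL T M cells = true) : CellsOKW wL T cells (twistWeight s) := by
  obtain ⟨hchain, hall, hs, hj, hT, hwL⟩ := checkCellsZS_spec h
  have hvalid : ∀ c ∈ cells, CellValidW c (twistWeight s) :=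
    fun c hc ↦ FPDCell.cellValidW_of_checkZS (hall c hc)
  refine ⟨hchain, hvalid, fun t ht ↦ ?_⟩
  have hT0 : (0 : ℝ) ≤ T := by exact_mod_cast (chain_boundsW hchain hvalid).1
  have hlev := wLoZ_le p (dyNum T j) hj M
  have hTe : ((dyNum T j : ℕ) : ℝ) / 2 ^ j = (T : ℝ) := by
    have : (T : ℝ) * 2 ^ j = ((dyNum T j : ℕ) : ℝ) := by exact_mod_cast hT
    rw [← this, mul_div_assoc, div_self (by positivity), mul_one]
  rw [hTe] at hlev
  have hwL' : ((wL : ℚ) : ℝ) + (rippleHiQ s : ℝ) ≤ (wLoZ p (dyNum T j) j M : ℝ) := by exact_mod_cast hwL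
  have htail := twistWeight_ge_tail (s := s) hT0 ht
  have hrip := abs_mul_cZero_le_rippleHiQ hs
  linarith

/-! ## Comparison with the true weights of the two parities -/

/-- For either parity `a ≤ 1`:
`twistWeight s τ ≤ Re ψ(1/4 + a/2 + iτ/2) + s · (−√2 log 2 cos(τ log 2))` (the parity bonus
`Re ψ(3/4 + iy) − Re ψ(1/4 + iy) = π/cosh(2πy) ≥ 0` is dropped; `BaseRungOddTransfer.lean`). [folklore] -/
theorem twistWeight_le_parity (s : ℤ) {a : ℕ} (ha : a ≤ 1) (τ : ℝ) :
    twistWeight s τ ≤ (Complex.digamma (1 / 4 + (a : ℂ) / 2 + τ / 2 * I)).re +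
      (s : ℝ) * (-(Real.sqrt 2 * Real.log 2 * Real.cos (τ * Real.log 2))) := by
  unfold twistWeight reDigammaQuarter
  have e0 : (1 / 4 + (τ : ℂ) / 2 * I : ℂ) = 1 / 4 + ((0 : ℕ) : ℂ) / 2 + τ / 2 * I := by push_cast; ring
  rcases Nat.le_one_iff_eq_zero_or_eq_one.1 ha with rfl | rfl
  · rw [e0]
  · have h := re_digamma_par_zero_le_one τ
    rw [← e0] at h
    linarith

end Summit.Ventures.WeilGRH

end
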